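import Mathlib.MeasureTheory.Function.UniformIntegrable
import Literature.Analysis.FluidPDE.LerayHopf
import HarnessLib

/-!
# Uniform smallness of height truncations along a compact `C(S; L^p)` family

Analysis/FluidPDE support file for the uniqueness theorem of Furioli–Lemarié-Rieusset–Terraneo
(`Literature.Analysis.FluidPDE.kato_unique` via `Literature/Analysis/FluidPDE/KatoUniqueness`). The proof of local
uniqueness splits each solution `u ∈ C([τ₀, τ₁]; L³)` as `u = u¹ + u²` with `u²` bounded
(`|u²| ≤ λ`) and `u¹ = 𝟙_{|u| ≥ λ} u` uniformly small in `L³` (the Calderón / Lions–Masmoudi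
splitting of an `L^p` field into a bounded part and a part small in `L^p`, made *uniform in
time* by compactness of the range `{u(t) : t ∈ [τ₀, τ₁]}` in `L³`).

* `Literature.Analysis.FluidPDE.norm_indicator_le_two_mul_norm_sub_add`: the pointwise perturbation inequality
  `|𝟙_{|f| ≥ C} f| ≤ 2 |f - g| + |𝟙_{|g| ≥ C/2} g|`.
* `Literature.Analysis.FluidPDE.ContinuousInLpOn.exists_forall_eLpNorm_indicator_le`: for `u ∈ C(S; L^p)`
  (accepted `Fluid.ContinuousInLpOn`), `S` compact, `1 ≤ p < ∞`, and `ε > 0` there is a height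
  `C` with `‖𝟙_{|u(t)| ≥ C} u(t)‖_{L^p} ≤ ε` for **all** `t ∈ S` (finite `ε`-net in `L^p` by
  compactness + Mathlib's uniform integrability of finite `L^p` families,
  `MeasureTheory.UniformIntegrable.spec`).

## References

* C. P. Calderón, *Existence of weak solutions for the Navier–Stokes equations with initial data
  in `L^p`*, Trans. AMS 318 (1990), 179–200, §1 (splitting `L^p ⊂ L² + L^r`).
* P.-L. Lions, N. Masmoudi, *Uniqueness of mild solutions of the Navier–Stokes system in `L^N`*,
  Comm. PDE 26 (2001), 2211–2226 (compactness of the range of a `C([0,T]; L^N)` solution).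
* P. G. Lemarié-Rieusset, *The Navier–Stokes problem in the 21st century* (2016), proof of
  Thm. 7.7, p. 148 (the splitting `u = W_{νt}u₀ - u₁` with `u₁` small in `L³`).
-/

noncomputable section

open MeasureTheory TopologicalSpace Set Function Filter Topology
open scoped ENNReal NNReal

namespace Literature.Analysis.FluidPDE

variable {X : Type*} [MeasureSpace X]
variable {F : Type*} [NormedAddCommGroup F]

omit [MeasureSpace X] in
/-- **Perturbation inequality for height truncations.** For `f g : X → F`, `C ≥ 0` and every
`x`: `‖𝟙_{C ≤ |f|} f (x)‖ ≤ 2 ‖f x - g x‖ + ‖𝟙_{C/2 ≤ |g|} g (x)‖` (case analysis: where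
`|f x| ≥ C` and `|g x| < C/2` one has `|f x - g x| > C/2 > |g x|`). [folklore] -/
theorem norm_indicator_le_two_mul_norm_sub_add (f g : X → F) (C : ℝ≥0) (x : X) :
    ‖{y | C ≤ ‖f y‖₊}.indicator f x‖ ≤
      2 * ‖f x - g x‖ + ‖{y | C / 2 ≤ ‖g y‖₊}.indicator g x‖ := by
  by_cases hf : x ∈ {y | C ≤ ‖f y‖₊}
  · rw [indicator_of_mem hf]
    have hfC : (C : ℝ) ≤ ‖f x‖ := by exact_mod_cast (hf : C ≤ ‖f x‖₊)
    by_cases hg : x ∈ {y | C / 2 ≤ ‖g y‖₊}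
    · rw [indicator_of_mem hg]
      calc ‖f x‖ ≤ ‖f x - g x‖ + ‖g x‖ := norm_le_norm_sub_add _ _
        _ ≤ 2 * ‖f x - g x‖ + ‖g x‖ := by linarith [norm_nonneg (f x - g x)]
    · rw [indicator_of_notMem hg, norm_zero, add_zero]
      have hgC : ‖g x‖ < C / 2 := by
        have h : ¬ (C / 2 ≤ ‖g x‖₊) := hg
        rw [not_le] at h
        exact_mod_cast h
      have h1 : ‖f x‖ ≤ ‖f x - g x‖ + ‖g x‖ := norm_le_norm_sub_add _ _
      have hC2 : (C : ℝ) / 2 < ‖f x - g x‖ := by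
        have : ((C / 2 : ℝ≥0) : ℝ) = (C : ℝ) / 2 := by push_cast; ring
        linarith
      linarith
  · rw [indicator_of_notMem hf, norm_zero]
    positivity

/-- **Uniform smallness of height truncations along a compact `C(S; L^p)` family.** Let
`u ∈ C(S; L^p(X; F))` (`Fluid.ContinuousInLpOn S p u`) with `S ⊆ ℝ` compact and `1 ≤ p < ∞`.
For every `ε > 0` there is a height `C` such that `‖𝟙_{C ≤ |u(t)|} u(t)‖_{L^p} ≤ ε` for all
`t ∈ S` simultaneously. Proof: cover `S` by finitely many `L^p`-balls
`{t | ‖u(t) - u(sᵢ)‖_p < ε/4}` (compactness and continuity in `L^p`), truncate the finite family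
`u(sᵢ)` uniformly (Mathlib's `UniformIntegrable.spec` with `uniformIntegrable_finite`), and
transfer by `norm_indicator_le_two_mul_norm_sub_add`. (Compact subsets of `L^p` are
`p`-uniformly integrable; the time-uniform Calderón splitting used by Lions–Masmoudi.) [folklore] -/
theorem ContinuousInLpOn.exists_forall_eLpNorm_indicator_le {S : Set ℝ} (hS : IsCompact S)
    {p : ℝ≥0∞} (hp : 1 ≤ p) (hp' : p ≠ ∞) {u : ℝ → X → F} (hu : ContinuousInLpOn S p u)
    {ε : ℝ} (hε : 0 < ε) :
    ∃ C : ℝ≥0, ∀ t ∈ S,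
      eLpNorm ({x | C ≤ ‖u t x‖₊}.indicator (u t)) p volume ≤ ENNReal.ofReal ε := by
  have hp0 : p ≠ 0 := (zero_lt_one.trans_le hp).ne'
  have hε4 : 0 < ENNReal.ofReal (ε / 4) := ENNReal.ofReal_pos.2 (by linarith)
  -- a finite `ε/4`-net in `L^p`
  set U : ℝ → Set ℝ := fun s => {t | eLpNorm (u t - u s) p volume < ENNReal.ofReal (ε / 4)}
    with hU_def
  have hU : ∀ s ∈ S, U s ∈ 𝓝[S] s := fun s hs =>
    (hu.2 s hs) (Iio_mem_nhds hε4)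
  obtain ⟨T, hTS, hcover⟩ := hS.elim_nhdsWithin_subcover U hU
  -- strongly measurable representatives of the net points
  have hrep : ∀ s : T, ∃ g : X → F, StronglyMeasurable g ∧ u s =ᵐ[volume] g := fun s =>
    ⟨(hu.1 s (hTS s s.2)).1.mk _, (hu.1 s (hTS s s.2)).1.stronglyMeasurable_mk,
      (hu.1 s (hTS s s.2)).1.ae_eq_mk⟩
  choose g hgm hge using hrep
  have hgp : ∀ s : T, MemLp (g s) p volume := fun s =>
    (hu.1 s (hTS s s.2)).ae_eq (hge s)
  -- uniform truncation of the finite family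
  have hUI : UniformIntegrable g p volume := uniformIntegrable_finite hp hp' hgp
  obtain ⟨C₀, hC₀⟩ := hUI.spec hp0 hp' (half_pos hε)
  refine ⟨2 * C₀, fun t ht => ?_⟩
  -- pick a net point near `t`
  obtain ⟨s, hsT, hts⟩ : ∃ s ∈ T, t ∈ U s := by
    have := hcover ht
    simp only [mem_iUnion, exists_prop] at this
    exact this
  have hsS : s ∈ S := hTS s hsT
  set sT : T := ⟨s, hsT⟩
  have hclose : eLpNorm (u t - g sT) p volume < ENNReal.ofReal (ε / 4) := by
    have h1 : eLpNorm (u t - g sT) p volume = eLpNorm (u t - u s) p volume :=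
      eLpNorm_congr_ae ((EventuallyEq.rfl).sub (hge sT).symm)
    rw [h1]
    exact hts
  -- pointwise comparison and `L^p` norms
  set G : X → ℝ := fun y => 2 * ‖u t y - g sT y‖ + ‖{y | C₀ ≤ ‖g sT y‖₊}.indicator (g sT) y‖
    with hG_def
  have hpt : ∀ x, ‖{y | 2 * C₀ ≤ ‖u t y‖₊}.indicator (u t) x‖ ≤ G x := by
    intro x
    have h := norm_indicator_le_two_mul_norm_sub_add (u t) (g sT) (2 * C₀) x
    have h2 : 2 * C₀ / 2 = C₀ := by ring
    rwa [h2] at h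
  have hm1 : AEStronglyMeasurable (fun y => 2 * ‖u t y - g sT y‖) volume :=
    (((hu.1 t ht).1.sub (hgm sT).aestronglyMeasurable).norm).const_mul 2
  have hm2 : AEStronglyMeasurable (fun y => ‖{y | C₀ ≤ ‖g sT y‖₊}.indicator (g sT) y‖) volume :=
    ((hgm sT).indicator (measurableSet_le measurable_const (hgm sT).nnnorm.measurable))
      |>.aestronglyMeasurable.norm
  have hsmul : eLpNorm (fun y => 2 * ‖u t y - g sT y‖) p volume =
      2 * eLpNorm (u t - g sT) p volume := by
    have h : (fun y => 2 * ‖u t y - g sT y‖) = (2 : ℝ) • fun y => ‖(u t - g sT) y‖ := by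
      funext y; simp [smul_eq_mul]
    rw [h, eLpNorm_const_smul, eLpNorm_norm, Real.enorm_eq_ofReal zero_le_two,
      ENNReal.ofReal_ofNat]
  calc eLpNorm ({y | 2 * C₀ ≤ ‖u t y‖₊}.indicator (u t)) p volume
      ≤ eLpNorm G p volume := eLpNorm_mono_real hpt
    _ ≤ eLpNorm (fun y => 2 * ‖u t y - g sT y‖) p volume +
          eLpNorm (fun y => ‖{y | C₀ ≤ ‖g sT y‖₊}.indicator (g sT) y‖) p volume :=
        eLpNorm_add_le hm1 hm2 hp
    _ = 2 * eLpNorm (u t - g sT) p volume +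
          eLpNorm ({y | C₀ ≤ ‖g sT y‖₊}.indicator (g sT)) p volume := by
        rw [hsmul, eLpNorm_norm]
    _ ≤ 2 * ENNReal.ofReal (ε / 4) + ENNReal.ofReal (ε / 2) :=
        add_le_add (mul_le_mul_right hclose.le 2) (hC₀ sT)
    _ = ENNReal.ofReal ε := by
        rw [← ENNReal.ofReal_ofNat, ← ENNReal.ofReal_mul (by norm_num),
          ← ENNReal.ofReal_add (by positivity) (by positivity)]
        congr 1
        ring

end Literature.Analysis.FluidPDE
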